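import Literature.NumberTheory.EllipticCurves.IsogenyTwoTorsionProofs
import Literature.NumberTheory.EllipticCurves.ThreeIsogeny
import Literature.NumberTheory.EllipticCurves.IsogenyQuadraticTwistProofs
import Literature.NumberTheory.EllipticCurves.ComplexMultiplicationIsogenyProofs
import HarnessLib

/-!
# CM over `ℚ`: every CM elliptic curve is `ℚ`-isogenous to one with CM by the maximal order — the table, proved

Sibling file (D-0014 append protocol; everything here is proved) of
`Literature.NumberTheory.EllipticCurves.ComplexMultiplicationIsogenyProofs`, whose named fact
`Literature.NumberTheory.EllipticCurves.exists_isIsogenous_j_mem_maximalCMJInvariants_of_j_mem_nonmaximalCMJInvariants` — an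
elliptic curve over `ℚ` with `j ∈ {54000, 287496, -12288000, 16581375}` (CM by the class-number-one
orders of conductor `f = 2, 2, 3, 2`) is isogenous over `ℚ` to one with `j ∈ maximalCMJInvariants`
— is **discharged** here (`…_holds`) from:

* the explicit `2`-isogeny `y² = x³ + ax² + bx → Y² = X³ - 2aX² + (a² - 4b)X` of
  `IsogenyTwoTorsionProofs` (Silverman, *AEC*, III.4.5) at `(a, b) = (6, -3)` (`j = 54000 ~ 0`),
  `(-6, 1)` (`j = 287496 ~ 1728`), `(-42, -7)` (`j = 16581375 ~ -3375`);
* Vélu's `3`-isogeny of `ThreeIsogeny` at `(m, s) = (6, -4)` (`j = -12288000 ~ 0`;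
  `isIsogenous_cm27`);
* transport along `j`: curves over `ℚ` with the same `j ≠ 0, 1728` are quadratic twists of each
  other up to a change of variables (`exists_variableChange_eq_quadraticTwist_of_j_eq`, Silverman
  *AEC* X.5.4), isogenies twist (`IsIsogenous.quadraticTwist`) and changes of variables are
  isogenies (`isIsogenous_smul`) — packaged as `exists_isIsogenous_j_eq_of_j_eq`.

Consequences: `exists_isIsogenous_j_mem_maximalCMJInvariants_of_hasCM` (fact `R1` of
`ComplexMultiplication.lean`) now follows from the classification `hasCM_iff_j_mem` alone
(`…_of_hasCM_iff_j_mem`), and the target fact `bsdRankFormula_of_hasCM_of_L_one_ne_zero` of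
`ComplexMultiplication.lean` from exactly: Coates–Wiles 1977 Thm. 1 (printed form), Knapp's
Thm. 11.67 (`L`-functions of isogenous curves) and `hasCM_iff_j_mem` (Heegner–Baker–Stark)
(`bsdRankFormula_of_hasCM_of_L_one_ne_zero_of_CoatesWiles1977_Knapp_classNumberOne`).

## References

* [SilvermanAEC2009] J. H. Silverman, *The Arithmetic of Elliptic Curves*, 2nd ed. (2009),
  III.4.5, X.5 Prop. 5.4 and Cor. 5.4.1, App. C §11 (C.11.3.1–2).
* [SilvermanAdvancedTopics1994] J. H. Silverman, *Advanced Topics*, GTM 151 (1994), II.2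
  (Exercise 2.12(b)), App. A §3 (the CM `j`-invariants in `ℚ`, conductor `f ≥ 2` rows).
* [CremonaAlgorithms1997] J. E. Cremona, *Algorithms for Modular Elliptic Curves*, 2nd ed. (1997),
  §3.8 (Vélu; "twisting commutes with isogenies"), Table 1 (classes `27a`, `32a`, `36a`, `49a`).
* [CoatesWiles1977] J. Coates, A. Wiles, *Invent. Math.* **39** (1977), Thm. 1.
* [Knapp1993] A. W. Knapp, *Elliptic Curves* (1992), Thm. 11.67.
-/

noncomputable section

open scoped Classical

open WeierstrassCurve

namespace Literature.NumberTheory.EllipticCurves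

/-! ## The three CM instances of the explicit `2`-isogeny -/

section TwoIsogenyCM

/-- `Δ(⟨0, a, 0, b, 0⟩) = 16 b² (a² - 4b)`. Silverman, *AEC*, X.4.9 (proof). [folklore] -/
theorem Δ_mk_twoTorsion (a b : ℚ) :
    (⟨0, a, 0, b, 0⟩ : WeierstrassCurve ℚ).Δ = 16 * b ^ 2 * (a ^ 2 - 4 * b) := by
  simp only [WeierstrassCurve.Δ, WeierstrassCurve.b₂, WeierstrassCurve.b₄, WeierstrassCurve.b₆,
    WeierstrassCurve.b₈]
  ring

/-- `c₄(⟨0, a, 0, b, 0⟩) = 16 (a² - 3b)`. [folklore] -/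
theorem c₄_mk_twoTorsion (a b : ℚ) :
    (⟨0, a, 0, b, 0⟩ : WeierstrassCurve ℚ).c₄ = 16 * (a ^ 2 - 3 * b) := by
  simp only [WeierstrassCurve.c₄, WeierstrassCurve.b₂, WeierstrassCurve.b₄]
  ring

/-- `⟨0, a, 0, b, 0⟩` is elliptic iff `16 b² (a² - 4b) ≠ 0`. [folklore] -/
theorem isElliptic_mk_twoTorsion_iff (a b : ℚ) :
    (⟨0, a, 0, b, 0⟩ : WeierstrassCurve ℚ).IsElliptic ↔ 16 * b ^ 2 * (a ^ 2 - 4 * b) ≠ 0 := by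
  rw [WeierstrassCurve.isElliptic_iff, Δ_mk_twoTorsion, isUnit_iff_ne_zero]

/-- `j(⟨0, a, 0, b, 0⟩) = 256 (a² - 3b)³ / (b² (a² - 4b))`. Silverman, *AEC*, III.1 (`j = c₄³/Δ`).
[folklore] -/
theorem j_mk_twoTorsion (a b : ℚ) [hE : (⟨0, a, 0, b, 0⟩ : WeierstrassCurve ℚ).IsElliptic] :
    (⟨0, a, 0, b, 0⟩ : WeierstrassCurve ℚ).j = 256 * (a ^ 2 - 3 * b) ^ 3 / (b ^ 2 * (a ^ 2 - 4 * b)) := by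
  have hΔ : 16 * b ^ 2 * (a ^ 2 - 4 * b) ≠ 0 := (isElliptic_mk_twoTorsion_iff a b).mp hE
  have h16 : (16 : ℚ) ≠ 0 := by norm_num
  have hb : b ^ 2 * (a ^ 2 - 4 * b) ≠ 0 := fun h => hΔ (by rw [mul_assoc, h]; ring)
  rw [WeierstrassCurve.j, Units.val_inv_eq_inv_val, WeierstrassCurve.coe_Δ', Δ_mk_twoTorsion,
    c₄_mk_twoTorsion]
  field_simp
  ring

/-- The codomain of the explicit `2`-isogeny of `⟨0, a, 0, b, 0⟩` is `⟨0, -2a, 0, a² - 4b, 0⟩`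
(unfolding `twoIsogenyCodomain`). Silverman, *AEC*, III.4.5. [folklore] -/
theorem twoIsogenyCodomain_mk (a b : ℚ) :
    (⟨0, a, 0, b, 0⟩ : WeierstrassCurve ℚ).twoIsogenyCodomain = ⟨0, -2 * a, 0, a ^ 2 - 4 * b, 0⟩ :=
  rfl

/-- `E₁₂ = ⟨0, 6, 0, -3, 0⟩` (`y² = x³ + 6x² - 3x`) is elliptic (`Δ = 6912`). [folklore] -/
instance isElliptic_cm12 : (⟨0, 6, 0, -3, 0⟩ : WeierstrassCurve ℚ).IsElliptic :=
  (isElliptic_mk_twoTorsion_iff _ _).mpr (by norm_num)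

/-- `E₁₂' = ⟨0, -12, 0, 48, 0⟩` is elliptic. [folklore] -/
instance isElliptic_cm12' : (⟨0, -12, 0, 48, 0⟩ : WeierstrassCurve ℚ).IsElliptic :=
  (isElliptic_mk_twoTorsion_iff _ _).mpr (by norm_num)

/-- `E₁₆ = ⟨0, -6, 0, 1, 0⟩` (`y² = x³ - 6x² + x`) is elliptic (`Δ = 512`). [folklore] -/
instance isElliptic_cm16 : (⟨0, -6, 0, 1, 0⟩ : WeierstrassCurve ℚ).IsElliptic :=
  (isElliptic_mk_twoTorsion_iff _ _).mpr (by norm_num)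

/-- `E₁₆' = ⟨0, 12, 0, 32, 0⟩` is elliptic. [folklore] -/
instance isElliptic_cm16' : (⟨0, 12, 0, 32, 0⟩ : WeierstrassCurve ℚ).IsElliptic :=
  (isElliptic_mk_twoTorsion_iff _ _).mpr (by norm_num)

/-- `E₂₈ = ⟨0, -42, 0, -7, 0⟩` (`y² = x³ - 42x² - 7x`) is elliptic. [folklore] -/
instance isElliptic_cm28 : (⟨0, -42, 0, -7, 0⟩ : WeierstrassCurve ℚ).IsElliptic :=
  (isElliptic_mk_twoTorsion_iff _ _).mpr (by norm_num)

/-- `E₂₈' = ⟨0, 84, 0, 1792, 0⟩` is elliptic. [folklore] -/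
instance isElliptic_cm28' : (⟨0, 84, 0, 1792, 0⟩ : WeierstrassCurve ℚ).IsElliptic :=
  (isElliptic_mk_twoTorsion_iff _ _).mpr (by norm_num)

/-- `j(E₁₂) = 54000 = 2⁴3³5³` (CM by the order of discriminant `-12`). Silverman,
*Advanced Topics*, A §3. [folklore] -/
theorem j_cm12 : (⟨0, 6, 0, -3, 0⟩ : WeierstrassCurve ℚ).j = 54000 := by
  rw [j_mk_twoTorsion]; norm_num

/-- `j(E₁₂') = 0`. [folklore] -/
theorem j_cm12' : (⟨0, -12, 0, 48, 0⟩ : WeierstrassCurve ℚ).j = 0 := by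
  rw [j_mk_twoTorsion]; norm_num

/-- `j(E₁₆) = 287496 = 2³3³11³` (CM by the order of discriminant `-16`). [folklore] -/
theorem j_cm16 : (⟨0, -6, 0, 1, 0⟩ : WeierstrassCurve ℚ).j = 287496 := by
  rw [j_mk_twoTorsion]; norm_num

/-- `j(E₁₆') = 1728`. [folklore] -/
theorem j_cm16' : (⟨0, 12, 0, 32, 0⟩ : WeierstrassCurve ℚ).j = 1728 := by
  rw [j_mk_twoTorsion]; norm_num

/-- `j(E₂₈) = 16581375 = 3³5³17³` (CM by the order of discriminant `-28`). [folklore] -/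
theorem j_cm28 : (⟨0, -42, 0, -7, 0⟩ : WeierstrassCurve ℚ).j = 16581375 := by
  rw [j_mk_twoTorsion]; norm_num

/-- `j(E₂₈') = -3375`. [folklore] -/
theorem j_cm28' : (⟨0, 84, 0, 1792, 0⟩ : WeierstrassCurve ℚ).j = -3375 := by
  rw [j_mk_twoTorsion]; norm_num

/-- **`j = 54000 ~ j = 0`**: `E₁₂ ~ E₁₂'` by the explicit `2`-isogeny (Silverman *AEC* III.4.5).
[cite: SilvermanAEC2009, III.4 Example 4.5] -/
theorem isIsogenous_cm12 :
    IsIsogenous (⟨0, 6, 0, -3, 0⟩ : WeierstrassCurve ℚ) ⟨0, -12, 0, 48, 0⟩ :=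
  isIsogenous_of_eq_twoIsogenyCodomain _ (by rw [twoIsogenyCodomain_mk]; norm_num)

/-- **`j = 287496 ~ j = 1728`**: `E₁₆ ~ E₁₆'` by the explicit `2`-isogeny.
[cite: SilvermanAEC2009, III.4 Example 4.5] -/
theorem isIsogenous_cm16 :
    IsIsogenous (⟨0, -6, 0, 1, 0⟩ : WeierstrassCurve ℚ) ⟨0, 12, 0, 32, 0⟩ :=
  isIsogenous_of_eq_twoIsogenyCodomain _ (by rw [twoIsogenyCodomain_mk]; norm_num)

/-- **`j = 16581375 ~ j = -3375`**: `E₂₈ ~ E₂₈'` by the explicit `2`-isogeny.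
[cite: SilvermanAEC2009, III.4 Example 4.5] -/
theorem isIsogenous_cm28 :
    IsIsogenous (⟨0, -42, 0, -7, 0⟩ : WeierstrassCurve ℚ) ⟨0, 84, 0, 1792, 0⟩ :=
  isIsogenous_of_eq_twoIsogenyCodomain _ (by rw [twoIsogenyCodomain_mk]; norm_num)

end TwoIsogenyCM

/-! ## Transport along `j` and the table -/

/-- **Transport of an explicit isogeny along `j`**: if `j(W) = j(E) ≠ 0, 1728` and `E ~ E'` over
`ℚ`, then `W` is isogenous over `ℚ` to an elliptic curve with `j`-invariant `j(E')` — namely to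
the quadratic twist `E'^{(d)}` for the `d` with `C • W = E^{(d)}`
(`exists_variableChange_eq_quadraticTwist_of_j_eq`, Silverman *AEC* X.5.4), since isogenies
twist (`IsIsogenous.quadraticTwist`) and changes of variables are isogenies
(`isIsogenous_smul`). Silverman, *AEC*, X.5 Cor. 5.4.1; Cremona, *Algorithms*, §3.8
("twisting commutes with isogenies"). [folklore] -/
theorem exists_isIsogenous_j_eq_of_j_eq {W E E' : WeierstrassCurve ℚ} [W.IsElliptic]
    [E.IsElliptic] [E'.IsElliptic] (hj : W.j = E.j) (h0 : E.j ≠ 0) (h1728 : E.j ≠ 1728)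
    (hiso : IsIsogenous E E') :
    ∃ (W' : WeierstrassCurve ℚ) (_ : W'.IsElliptic), IsIsogenous W W' ∧ W'.j = E'.j := by
  obtain ⟨d, hd, C, hC⟩ := exists_variableChange_eq_quadraticTwist_of_j_eq hj h0 h1728
  haveI := E'.isElliptic_quadraticTwist hd
  refine ⟨E'.quadraticTwist d, ‹_›, ?_, E'.j_quadraticTwist hd⟩
  have h1 : IsIsogenous W (C • W) := isIsogenous_smul W C
  rw [hC] at h1
  exact h1.trans' (hiso.quadraticTwist hd)

/-- **The table fact holds**: every elliptic curve over `ℚ` with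
`j ∈ {54000, 287496, -12288000, 16581375}` is isogenous over `ℚ` to one with
`j ∈ maximalCMJInvariants` (indeed with `j = 0, 1728, 0, -3375` respectively): the explicit
`2`-isogenies `isIsogenous_cm12/16/28` and Vélu's `3`-isogeny `isIsogenous_cm27`, transported
along `j` by `exists_isIsogenous_j_eq_of_j_eq`. Discharges
`exists_isIsogenous_j_mem_maximalCMJInvariants_of_j_mem_nonmaximalCMJInvariants`.
[cite: SilvermanAdvancedTopics1994, Exercise 2.12(b) and App. A §3] -/
theorem exists_isIsogenous_j_mem_maximalCMJInvariants_of_j_mem_nonmaximalCMJInvariants_holds :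
    exists_isIsogenous_j_mem_maximalCMJInvariants_of_j_mem_nonmaximalCMJInvariants := by
  intro W _ hj
  simp only [nonmaximalCMJInvariants, Finset.mem_insert, Finset.mem_singleton] at hj
  rcases hj with hj | hj | hj | hj
  · -- `j = 54000 ~ 0`
    obtain ⟨W', hW', hiso, hjW'⟩ := exists_isIsogenous_j_eq_of_j_eq (W := W)
      (by rw [hj, j_cm12]) (by rw [j_cm12]; norm_num) (by rw [j_cm12]; norm_num) isIsogenous_cm12
    exact ⟨W', hW', hiso, by rw [hjW', j_cm12']; decide⟩
  · -- `j = 287496 ~ 1728`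
    obtain ⟨W', hW', hiso, hjW'⟩ := exists_isIsogenous_j_eq_of_j_eq (W := W)
      (by rw [hj, j_cm16]) (by rw [j_cm16]; norm_num) (by rw [j_cm16]; norm_num) isIsogenous_cm16
    exact ⟨W', hW', hiso, by rw [hjW', j_cm16']; decide⟩
  · -- `j = -12288000 ~ 0`
    haveI := isElliptic_threeIsogenyCodomain (m := (6 : ℚ)) (s := -4)
    obtain ⟨W', hW', hiso, hjW'⟩ := exists_isIsogenous_j_eq_of_j_eq (W := W)
      (E := threeTorsionModel (6 : ℚ) (-4)) (E' := threeIsogenyCodomain (6 : ℚ) (-4))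
      (by rw [hj, j_threeTorsionModel_cm27]) (by rw [j_threeTorsionModel_cm27]; norm_num)
      (by rw [j_threeTorsionModel_cm27]; norm_num) isIsogenous_cm27
    exact ⟨W', hW', hiso, by rw [hjW', j_threeIsogenyCodomain_cm27]; decide⟩
  · -- `j = 16581375 ~ -3375`
    obtain ⟨W', hW', hiso, hjW'⟩ := exists_isIsogenous_j_eq_of_j_eq (W := W)
      (by rw [hj, j_cm28]) (by rw [j_cm28]; norm_num) (by rw [j_cm28]; norm_num) isIsogenous_cm28
    exact ⟨W', hW', hiso, by rw [hjW', j_cm28']; decide⟩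

/-- **`R1` from the class-number-one classification alone**: given `hasCM_iff_j_mem`
(Silverman *AEC* C.11.3.1–2, Heegner–Baker–Stark), every CM elliptic curve over `ℚ` is
`ℚ`-isogenous to one with CM by the maximal order (the named fact
`exists_isIsogenous_j_mem_maximalCMJInvariants_of_hasCM` of `ComplexMultiplication.lean`), the
table being proved above. Silverman, *Advanced Topics*, II Exercise 2.12(b).
[cite: SilvermanAdvancedTopics1994, Exercise 2.12(b)] -/
theorem exists_isIsogenous_j_mem_maximalCMJInvariants_of_hasCM_of_hasCM_iff_j_mem
    (h13 : hasCM_iff_j_mem) : exists_isIsogenous_j_mem_maximalCMJInvariants_of_hasCM :=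
  exists_isIsogenous_j_mem_maximalCMJInvariants_of_hasCM_of_table h13
    exists_isIsogenous_j_mem_maximalCMJInvariants_of_j_mem_nonmaximalCMJInvariants_holds

/-- **The finiteness fact from three printed statements.** `finite_point_of_hasCM_of_L_one_ne_zero`
(`ComplexMultiplication.lean`) follows from Coates–Wiles 1977 Thm. 1 (`hCW`), Knapp's Thm. 11.67
(`hR2`) and the classification `hasCM_iff_j_mem` (`h13`); the isogeny to maximal CM is now proved.
[cite: CoatesWiles1977, Theorem 1] -/
theorem finite_point_of_hasCM_of_L_one_ne_zero_of_CoatesWiles1977_Knapp_classNumberOne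
    (hCW : CoatesWiles1977_L_one_eq_zero_of_not_isOfFinAddOrder)
    (hR2 : LFunction_eq_of_isIsogenous) (h13 : hasCM_iff_j_mem) :
    finite_point_of_hasCM_of_L_one_ne_zero :=
  finite_point_of_hasCM_of_L_one_ne_zero_of_CoatesWiles1977 hCW
    (exists_isIsogenous_j_mem_maximalCMJInvariants_of_hasCM_of_hasCM_iff_j_mem h13) hR2

/-- **The target fact from three printed statements.** The Birch–Swinnerton-Dyer rank formula
for CM curves with `L(E, 1) ≠ 0`, `bsdRankFormula_of_hasCM_of_L_one_ne_zero`
(`ComplexMultiplication.lean`), follows from exactly: Coates–Wiles 1977 Thm. 1 in its printed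
form (`hCW`), Knapp's Thm. 11.67 on `L`-functions of isogenous curves (`hR2`), and the
classification of CM `j`-invariants in `ℚ` (`h13`, Heegner–Baker–Stark); Mordell–Weil, the
analytic-rank glue and the isogeny to maximal CM being proved in the tree.
[cite: CoatesWiles1977, Theorem 1] -/
theorem bsdRankFormula_of_hasCM_of_L_one_ne_zero_of_CoatesWiles1977_Knapp_classNumberOne
    (hCW : CoatesWiles1977_L_one_eq_zero_of_not_isOfFinAddOrder)
    (hR2 : LFunction_eq_of_isIsogenous) (h13 : hasCM_iff_j_mem) :
    bsdRankFormula_of_hasCM_of_L_one_ne_zero :=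
  bsdRankFormula_of_hasCM_of_L_one_ne_zero_of_CoatesWiles1977 hCW
    (exists_isIsogenous_j_mem_maximalCMJInvariants_of_hasCM_of_hasCM_iff_j_mem h13) hR2

/-! ## `R1` from the `only if` half of the classification

`ComplexMultiplicationIsogenyProofs.lean` isolates the half of `hasCM_iff_j_mem` that the
reduction uses, `j_mem_cmJInvariants_of_hasCM` (`HasCM E → j(E) ∈ cmJInvariants`; Silverman,
*AEC*, App. C, Examples 11.3.1–11.3.2). With the table proved above, the isogeny fact `R1`
(`exists_isIsogenous_j_mem_maximalCMJInvariants_of_hasCM` of `ComplexMultiplication.lean`)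
follows from that half alone. (The sharper statement *with* equal `L`-functions, and the
assemblies of `finite_point_of_hasCM_of_L_one_ne_zero` / `bsdRankFormula_of_hasCM_of_L_one_ne_zero`
from Coates–Wiles and `j_mem_cmJInvariants_of_hasCM` only, live downstream in
`ComplexMultiplicationLFunctionTableProofs.lean`, which discharges Knapp's Thm. 11.67 for the four
classes and their twists.) -/

/-- **`R1` from the `only if` half of the classification**: every CM elliptic curve over `ℚ` is
`ℚ`-isogenous to one with `j ∈ maximalCMJInvariants`, granted only `HasCM E → j(E) ∈ cmJInvariants`
(`h₁`); the table is `…_of_j_mem_nonmaximalCMJInvariants_holds`.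
[cite: SilvermanAdvancedTopics1994, Exercise 2.12(b)] -/
theorem exists_isIsogenous_j_mem_maximalCMJInvariants_of_hasCM_of_j_mem
    (h₁ : j_mem_cmJInvariants_of_hasCM) : exists_isIsogenous_j_mem_maximalCMJInvariants_of_hasCM :=
  exists_isIsogenous_j_mem_maximalCMJInvariants_of_hasCM_of_j_mem_of_table h₁
    exists_isIsogenous_j_mem_maximalCMJInvariants_of_j_mem_nonmaximalCMJInvariants_holds

end Literature.NumberTheory.EllipticCurves

end
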